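import Mathlib.Analysis.Asymptotics.Lemmas
import Mathlib.Analysis.Calculus.MeanValue
import Literature.Analysis.FunctionSpaces.ContDiffHolderFDerivCLM
import HarnessLib

/-!
# Joint smoothness of the evaluation map `(f, x) ↦ f x` on `C^{k,r}_b` (Hölder spaces, part 28)

Topic `Literature/Analysis/FunctionSpaces`. On the Banach spaces `C^{k,r}_b(E, F)` of part 3
(`ContDiffHolderFunction`) the **evaluation map** `ev : C^{k,r}_b(E, F) × E → F`, `(f, x) ↦ f x`,
is jointly `C^k` (`ContDiffHolderFunction.contDiff_eval`), and consequently, for a `C^n` family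
`Λ : B → C^{k,r}_b(E, F)` on an open set `U` of a normed parameter space `B` with `n ≤ k`, the
two-variable map `(b, x) ↦ Λ b x` is `C^n` on `U × E` (`ContDiffHolderFunction.contDiffOn_eval`).
This is the bookkeeping step that turns implicit-function-theorem output "`b ↦ u_b` is a smooth
map into a Hölder space" into genuine smoothness of the solution `(b, x) ↦ u_b(x)` in all
variables, as used for parameter-dependent families of solutions of elliptic equations.

Proof. Induction on `k`, for all complete targets at once.
* `x ↦ ev_x ∈ (C^{k+1,r}_b(E, G) →L[ℝ] G)` is `C^k` **in the operator norm**
  (`contDiff_evalCLM_succ`): it is `1`-Lipschitz (`‖f x − f y‖ ≤ ‖f‖ ‖x − y‖`, mean value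
  inequality with `‖Df‖ ≤ ‖f‖`), and on `C^{k+2,r}_b` it has the derivative `v ↦ (f ↦ Df(x) v)` —
  the flip of `ev_x ∘L fderivCLM` with `ev_x` on `C^{k+1,r}_b(E, E →L G)` — by the Taylor bound
  `‖f(x + v) − f(x) − Df(x) v‖ ≤ ‖f‖ ‖v‖²` (the derivative of a member is `‖f‖`-Lipschitz).
* `ev` is `C^k` on `C^{k,r}_b(E, G) × E` (`contDiff_eval`): continuity for `k = 0`
  (`‖f x − f₀ x₀‖ ≤ ‖f − f₀‖ + ‖f₀ x − f₀ x₀‖`); on `C^{k+1,r}_b × E` the derivative at `(f, x)` is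
  `(φ, v) ↦ φ x + Df(x) v = ev_x ∘L fst + Df(x) ∘L snd`, whose first term is `C^k` by the previous
  point and whose second is the evaluation of `C^{k,r}_b(E, E →L G)` at `(fderivCLM f, x)`.
* `(b, x) ↦ Λ b x = ev (Λ b, x)` is then `C^n` by the chain rule.

Everything is proved; no named facts. The spaces `E`, `F` live in one universe (the induction
changes the target to `E →L[ℝ] F`).

## References

* D. Gilbarg, N. S. Trudinger, *Elliptic Partial Differential Equations of Second Order* (2001),
  §4.1. [GilbargTrudinger2001]
-/

noncomputable section

open Set Filter Topology Asymptotics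
open scoped NNReal

universe u

namespace Literature.Analysis.FunctionSpaces

namespace ContDiffHolderFunction

/-! ### Mean value and Taylor bounds for members -/

section Estimates

variable {E F : Type*} [NormedAddCommGroup E] [NormedSpace ℝ E] [NormedAddCommGroup F]
  [NormedSpace ℝ F] {k : ℕ} {r : ℝ≥0}

/-- **Members of `C^{k+1,r}_b` are Lipschitz with constant `‖f‖`**: `‖f x − f y‖ ≤ ‖f‖ ‖x − y‖`
(mean value inequality, `‖Df‖ ≤ ‖f‖`). [folklore] -/
theorem norm_apply_sub_apply_le (f : ContDiffHolderFunction E F (k + 1) r) (x y : E) :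
    ‖f x - f y‖ ≤ ‖f‖ * ‖x - y‖ :=
  (convex_univ).norm_image_sub_le_of_norm_fderiv_le
    (fun z _ => f.contDiff.differentiable (by exact_mod_cast Nat.succ_ne_zero k) z)
    (fun z _ => f.norm_fderiv_apply_le z) (mem_univ y) (mem_univ x)

/-- `‖D(Df)(x)‖ ≤ ‖f‖` for `f ∈ C^{k+2,r}_b`. [folklore] -/
theorem norm_fderiv_fderiv_le (f : ContDiffHolderFunction E F (k + 2) r) (x : E) :
    ‖fderiv ℝ (fderiv ℝ (f : E → F)) x‖ ≤ ‖f‖ := by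
  rw [← norm_iteratedFDeriv_one (𝕜 := ℝ), norm_iteratedFDeriv_fderiv]
  exact f.norm_iteratedFDeriv_le_norm (by omega) x

/-- **The derivative of a member of `C^{k+2,r}_b` is Lipschitz with constant `‖f‖`.** [folklore] -/
theorem norm_fderiv_sub_fderiv_le (f : ContDiffHolderFunction E F (k + 2) r) (x y : E) :
    ‖fderiv ℝ (f : E → F) x - fderiv ℝ (f : E → F) y‖ ≤ ‖f‖ * ‖x - y‖ := by
  have hd : Differentiable ℝ (fderiv ℝ (f : E → F)) :=
    (f.contDiff.fderiv_right (m := 1) (by exact_mod_cast (by omega : 1 + 1 ≤ k + 2))).differentiable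
      one_ne_zero
  exact (convex_univ).norm_image_sub_le_of_norm_fderiv_le (fun z _ => hd z)
    (fun z _ => f.norm_fderiv_fderiv_le z) (mem_univ y) (mem_univ x)

/-- **First-order Taylor bound** for `f ∈ C^{k+2,r}_b`: `‖f(x + v) − f(x) − Df(x) v‖ ≤ ‖f‖ ‖v‖²`
(mean value inequality for `y ↦ f y − Df(x) y` on the ball of radius `‖v‖` about `x`, `Df` being
`‖f‖`-Lipschitz). [folklore] -/
theorem norm_apply_add_sub_sub_le (f : ContDiffHolderFunction E F (k + 2) r) (x v : E) :
    ‖f (x + v) - f x - fderiv ℝ (f : E → F) x v‖ ≤ ‖f‖ * ‖v‖ ^ 2 := by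
  have hdf : Differentiable ℝ (f : E → F) :=
    f.contDiff.differentiable (by exact_mod_cast Nat.succ_ne_zero (k + 1))
  set L : E →L[ℝ] F := fderiv ℝ (f : E → F) x with hL
  have hconv : Convex ℝ (Metric.closedBall x ‖v‖) := convex_closedBall x ‖v‖
  have hxs : x ∈ Metric.closedBall x ‖v‖ := Metric.mem_closedBall_self (norm_nonneg v)
  have hxvs : x + v ∈ Metric.closedBall x ‖v‖ := by
    simp [Metric.mem_closedBall, dist_eq_norm]
  have hψ : ∀ y ∈ Metric.closedBall x ‖v‖, HasFDerivWithinAt (fun y => f y - L y)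
      (fderiv ℝ (f : E → F) y - L) (Metric.closedBall x ‖v‖) y := fun y _ =>
    ((hdf y).hasFDerivAt.sub L.hasFDerivAt).hasFDerivWithinAt
  have hbound : ∀ y ∈ Metric.closedBall x ‖v‖, ‖fderiv ℝ (f : E → F) y - L‖ ≤ ‖f‖ * ‖v‖ := by
    intro y hy
    rw [Metric.mem_closedBall, dist_eq_norm] at hy
    exact (f.norm_fderiv_sub_fderiv_le y x).trans (by gcongr)
  have h := hconv.norm_image_sub_le_of_norm_hasFDerivWithin_le hψ hbound hxs hxvs
  calc ‖f (x + v) - f x - L v‖ = ‖(f (x + v) - L (x + v)) - (f x - L x)‖ := by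
        rw [L.map_add]
        congr 1
        abel
    _ ≤ ‖f‖ * ‖v‖ * ‖x + v - x‖ := h
    _ = ‖f‖ * ‖v‖ ^ 2 := by
        rw [add_sub_cancel_left]
        ring

/-- **`x ↦ ev_x` is `1`-Lipschitz in the operator norm on `C^{k+1,r}_b`**:
`‖ev_x − ev_y‖ ≤ ‖x − y‖`. [folklore] -/
theorem norm_evalCLM_sub_evalCLM_le (x y : E) :
    ‖(evalCLM x - evalCLM y : ContDiffHolderFunction E F (k + 1) r →L[ℝ] F)‖ ≤ ‖x - y‖ :=
  ContinuousLinearMap.opNorm_le_bound _ (norm_nonneg _) fun f => by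
    rw [sub_apply, evalCLM_apply, evalCLM_apply, mul_comm]
    exact f.norm_apply_sub_apply_le x y

/-- `x ↦ ev_x ∈ (C^{k+1,r}_b(E, F) →L[ℝ] F)` is continuous in the operator norm. [folklore] -/
theorem continuous_evalCLM_succ :
    Continuous fun x : E => (evalCLM x : ContDiffHolderFunction E F (k + 1) r →L[ℝ] F) :=
  continuous_iff_continuousAt.2 fun x => by
    rw [ContinuousAt, tendsto_iff_norm_sub_tendsto_zero]
    exact squeeze_zero (fun y => norm_nonneg _) (fun y => norm_evalCLM_sub_evalCLM_le y x)
      (tendsto_norm_sub_self x)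

end Estimates

/-! ### Smoothness of `x ↦ ev_x` in the operator norm, and of `(f, x) ↦ f x` -/

section Smooth

variable {E : Type u} [NormedAddCommGroup E] [NormedSpace ℝ E] {r : ℝ≥0}

/-- **`x ↦ ev_x ∈ (C^{k+1,r}_b(E, G) →L[ℝ] G)` is `C^k` in the operator norm** for every complete
`G` (induction on `k`: it is `1`-Lipschitz; on `C^{k+2,r}_b` it has the derivative
`v ↦ (f ↦ Df(x) v)`, the flip of `ev_x ∘L fderivCLM` with `ev_x` on `C^{k+1,r}_b(E, E →L G)`,
by the Taylor bound `‖f(x + v) − f(x) − Df(x) v‖ ≤ ‖f‖ ‖v‖²`). [folklore] -/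
theorem contDiff_evalCLM_succ :
    ∀ (k : ℕ) {G : Type u} [NormedAddCommGroup G] [NormedSpace ℝ G] [CompleteSpace G],
      ContDiff ℝ k fun x : E => (evalCLM x : ContDiffHolderFunction E G (k + 1) r →L[ℝ] G) := by
  intro k
  induction k with
  | zero =>
    intro G _ _ _
    rw [Nat.cast_zero, contDiff_zero]
    exact continuous_evalCLM_succ
  | succ k ih =>
    intro G _ _ _
    rw [Nat.cast_succ, contDiff_succ_iff_hasFDerivAt]
    refine ⟨fun x => ContinuousLinearMap.flipₗᵢ ℝ (ContDiffHolderFunction E G (k + 1 + 1) r) E G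
        ((evalCLM (E := E) (F := E →L[ℝ] G) (k := k + 1) (r := r) x).comp
          (fderivCLM (E := E) (F := G) (k := k + 1) (r := r))), ?_, fun x => ?_⟩
    · exact (LinearIsometryEquiv.contDiff
          (E := ContDiffHolderFunction E G (k + 1 + 1) r →L[ℝ] E →L[ℝ] G)
          (F := E →L[ℝ] ContDiffHolderFunction E G (k + 1 + 1) r →L[ℝ] G)
          (ContinuousLinearMap.flipₗᵢ ℝ (ContDiffHolderFunction E G (k + 1 + 1) r) E G)).comp
        ((ih (G := E →L[ℝ] G)).clm_comp
          (contDiff_const (c := fderivCLM (E := E) (F := G) (k := k + 1) (r := r))))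
    · rw [hasFDerivAt_iff_isLittleO_nhds_zero]
      refine IsBigO.trans_isLittleO ?_ (isLittleO_norm_pow_id one_lt_two)
      refine IsBigO.of_bound 1 (Eventually.of_forall fun v => ?_)
      rw [Real.norm_of_nonneg (sq_nonneg _), one_mul]
      refine ContinuousLinearMap.opNorm_le_bound _ (sq_nonneg _) fun f => ?_
      have hval : ((evalCLM (x + v) - evalCLM x -
          ContinuousLinearMap.flipₗᵢ ℝ (ContDiffHolderFunction E G (k + 1 + 1) r) E G
            ((evalCLM (E := E) (F := E →L[ℝ] G) (k := k + 1) (r := r) x).comp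
              (fderivCLM (E := E) (F := G) (k := k + 1) (r := r))) v :
            ContDiffHolderFunction E G (k + 1 + 1) r →L[ℝ] G) f) =
          f (x + v) - f x - fderiv ℝ (f : E → G) x v := rfl
      rw [hval, mul_comm]
      exact f.norm_apply_add_sub_sub_le x v

/-- **The evaluation map `(f, x) ↦ f x` is `C^k` on `C^{k,r}_b(E, G) × E`** for every complete `G`
(induction on `k`: joint continuity for `k = 0`; on `C^{k+1,r}_b × E` the derivative at `(f, x)`
is `(φ, v) ↦ φ x + Df(x) v = ev_x ∘L fst + Df(x) ∘L snd`, whose first term is `C^k` in the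
operator norm by `contDiff_evalCLM_succ` and whose second is the evaluation of
`C^{k,r}_b(E, E →L G)` at `(fderivCLM f, x)`). [folklore] -/
theorem contDiff_eval :
    ∀ (k : ℕ) {G : Type u} [NormedAddCommGroup G] [NormedSpace ℝ G] [CompleteSpace G],
      ContDiff ℝ k fun p : ContDiffHolderFunction E G k r × E => p.1 p.2 := by
  intro k
  induction k with
  | zero =>
    intro G _ _ _
    rw [Nat.cast_zero, contDiff_zero]
    refine continuous_iff_continuousAt.2 fun p => ?_
    rw [ContinuousAt, tendsto_iff_norm_sub_tendsto_zero]
    have hb : ∀ q : ContDiffHolderFunction E G 0 r × E,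
        ‖q.1 q.2 - p.1 p.2‖ ≤ ‖q - p‖ + ‖p.1 q.2 - p.1 p.2‖ := fun q => by
      have h1 : ‖(q.1 - p.1) q.2‖ ≤ ‖q - p‖ :=
        ((q.1 - p.1).norm_apply_le_norm q.2).trans (norm_fst_le (q - p))
      calc ‖q.1 q.2 - p.1 p.2‖ = ‖(q.1 - p.1) q.2 + (p.1 q.2 - p.1 p.2)‖ := by
            rw [coe_sub, Pi.sub_apply, sub_add_sub_cancel]
        _ ≤ ‖(q.1 - p.1) q.2‖ + ‖p.1 q.2 - p.1 p.2‖ := norm_add_le _ _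
        _ ≤ ‖q - p‖ + ‖p.1 q.2 - p.1 p.2‖ := by gcongr
    have hc : Continuous fun q : ContDiffHolderFunction E G 0 r × E => p.1 q.2 :=
      p.1.continuous.comp continuous_snd
    have h2 : Tendsto (fun q : ContDiffHolderFunction E G 0 r × E => ‖p.1 q.2 - p.1 p.2‖) (𝓝 p)
        (𝓝 0) :=
      tendsto_iff_norm_sub_tendsto_zero.1 (hc.tendsto p)
    refine squeeze_zero (fun q => norm_nonneg _) hb ?_
    simpa using (tendsto_norm_sub_self p).add h2
  | succ k ih =>
    intro G _ _ _
    rw [Nat.cast_succ, contDiff_succ_iff_hasFDerivAt]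
    refine ⟨fun p => (evalCLM (E := E) (F := G) (k := k + 1) (r := r) p.2).comp
        (ContinuousLinearMap.fst ℝ (ContDiffHolderFunction E G (k + 1) r) E) +
      (fderiv ℝ (p.1 : E → G) p.2).comp
        (ContinuousLinearMap.snd ℝ (ContDiffHolderFunction E G (k + 1) r) E), ?_, fun p => ?_⟩
    · -- the derivative is `C^k`
      refine ContDiff.add ?_ ?_
      · exact ((contDiff_evalCLM_succ (E := E) (r := r) k (G := G)).comp contDiff_snd).clm_comp
          contDiff_const
      · have h1 : ContDiff ℝ k fun p : ContDiffHolderFunction E G (k + 1) r × E =>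
            ((fderivCLM (E := E) (F := G) (k := k) (r := r) p.1, p.2) :
              ContDiffHolderFunction E (E →L[ℝ] G) k r × E) :=
          ((fderivCLM (E := E) (F := G) (k := k) (r := r)).contDiff.comp contDiff_fst).prodMk
            contDiff_snd
        exact ((ih (G := E →L[ℝ] G)).comp h1).clm_comp contDiff_const
    · -- differentiability at `p = (f, x)`
      rw [hasFDerivAt_iff_isLittleO_nhds_zero]
      -- the Taylor term of the fixed member `f` at `x`, read through the second projection
      have hA : (fun h : ContDiffHolderFunction E G (k + 1) r × E =>
          p.1 (p.2 + h.2) - p.1 p.2 - fderiv ℝ (p.1 : E → G) p.2 h.2) =o[𝓝 0] fun h => h := by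
        have hd : HasFDerivAt (p.1 : E → G) (fderiv ℝ (p.1 : E → G) p.2) p.2 :=
          (p.1.contDiff.differentiable (by exact_mod_cast Nat.succ_ne_zero k) p.2).hasFDerivAt
        have ht : Tendsto (Prod.snd : ContDiffHolderFunction E G (k + 1) r × E → E) (𝓝 0) (𝓝 0) :=
          continuous_snd.tendsto' _ _ rfl
        refine ((hasFDerivAt_iff_isLittleO_nhds_zero.1 hd).comp_tendsto ht).trans_isBigO ?_
        exact IsBigO.of_bound 1 (Eventually.of_forall fun h => by simpa using norm_snd_le h)
      -- the cross term `φ(x + v) − φ(x)` is `O(‖φ‖ ‖v‖) = O(‖h‖²)`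
      have hB : (fun h : ContDiffHolderFunction E G (k + 1) r × E =>
          h.1 (p.2 + h.2) - h.1 p.2) =o[𝓝 0] fun h => h := by
        refine IsBigO.trans_isLittleO ?_ (isLittleO_norm_pow_id one_lt_two)
        refine IsBigO.of_bound 1 (Eventually.of_forall fun h => ?_)
        rw [Real.norm_of_nonneg (sq_nonneg _), one_mul]
        calc ‖h.1 (p.2 + h.2) - h.1 p.2‖ ≤ ‖h.1‖ * ‖p.2 + h.2 - p.2‖ :=
              h.1.norm_apply_sub_apply_le _ _
          _ = ‖h.1‖ * ‖h.2‖ := by rw [add_sub_cancel_left]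
          _ ≤ ‖h‖ * ‖h‖ :=
              mul_le_mul (norm_fst_le h) (norm_snd_le h) (norm_nonneg _) (norm_nonneg _)
          _ = ‖h‖ ^ 2 := (sq _).symm
      refine (hA.add hB).congr_left fun h => ?_
      simp only [Prod.fst_add, Prod.snd_add, add_apply, ContinuousLinearMap.comp_apply,
        ContinuousLinearMap.coe_fst', ContinuousLinearMap.coe_snd', evalCLM_apply, coe_add,
        Pi.add_apply]
      abel

end Smooth

/-! ### Joint smoothness of parametrised evaluation -/

/-- **Joint smoothness of evaluation.** Let `Λ : B → C^{k,r}_b(E, F)` be `C^n` on an open set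
`U ⊆ B` of a real normed space, with `n ≤ k` and `F` complete. Then the two-variable map
`(b, x) ↦ Λ b x` is `C^n` on `U × E`: it is the composite of `(b, x) ↦ (Λ b, x)` with the
evaluation map `C^{k,r}_b(E, F) × E → F`, which is jointly `C^k` (`contDiff_eval`: its derivative
at `(f, x)` is `(φ, v) ↦ φ x + Df(x) v`). [folklore] -/
theorem contDiffOn_eval {E F : Type} [NormedAddCommGroup E] [NormedSpace ℝ E]
    [NormedAddCommGroup F] [NormedSpace ℝ F] [CompleteSpace F]
    {B : Type*} [NormedAddCommGroup B] [NormedSpace ℝ B]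
    {k : ℕ} {r : ℝ≥0} {n : ℕ∞} (hn : (n : WithTop ℕ∞) ≤ k)
    (Λ : B → ContDiffHolderFunction E F k r) {U : Set B} (hU : IsOpen U)
    (hΛ : ContDiffOn ℝ n Λ U) :
    ContDiffOn ℝ n (fun p : B × E => Λ p.1 p.2) (U ×ˢ univ) := by
  have _ := hU
  have hev : ContDiff ℝ n fun q : ContDiffHolderFunction E F k r × E => q.1 q.2 :=
    (contDiff_eval (E := E) (r := r) k (G := F)).of_le hn
  have hpair : ContDiffOn ℝ n (fun p : B × E => (Λ p.1, p.2)) (U ×ˢ univ) :=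
    (hΛ.comp contDiffOn_fst fun p hp => (mem_prod.1 hp).1).prodMk contDiffOn_snd
  exact hev.comp_contDiffOn hpair

end ContDiffHolderFunction

end Literature.Analysis.FunctionSpaces

end
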